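/-
Origin: expansion seat `planner-pub-hodgecm-toy2-g2-0`, handover #3 2026-08-18T05:04:00Z (`HOME/pub-hodgecm-toy2-g2/lean/Toy2g2/StarTop.lean`, md5 bb6b7cfa, 150 lines);
landed by the gen-6 packager in gate run 22 as `HodgeCM/Model/Toy/StarTop.lean` (verbatim).
-/
/-
Copyright: pub-hodgecm formalisation cell (harness21, 2026). New file (not vendored).
Origin: HOME/pub-hodgecm-toy2-g2/lean/Toy2g2/StarTop.lean (WIP module `Toy2g2.StarTop`; intended final place
`HodgeCM/Model/Toy/StarTop.lean` = module `HodgeCM.Model.Toy.StarTop`, CONTRIBUTING §3 L5) (seat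
planner-pub-hodgecm-toy2-g2-0, consistency seat 2 gen 2, towards M28 `Fact_algDuality` in the toy universe).
-/
import Mathlib

/-!
# Exterior powers: complementary wedge-basis products and the top power

Pure multilinear algebra over a field `R`, for a module `V` with a basis `e` indexed by a finite linear order `I`:

* `basis_compl_mul_eq`: `e_{Tᶜ} ∧ z = ± (coord_T z) · e_{univ}` for `z ∈ ⋀^l V`, `|T| = l`, `k + l = |I|`
  (all other wedge-basis components of `z` are killed by `e_{Tᶜ}`);
* `eq_zero_of_forall_basis_mul_eq_zero`: the wedge pairing `⋀^k V × ⋀^l V → ⋀^{k+l} V` has no right kernel;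
* `eq_coord_smul_top`: the top power is the line spanned by `e_{univ}`;
* `map_eq_det_smul`: an endomorphism `f` acts on the top power `⋀^{dim V} V` by `det f`.
-/

noncomputable section

namespace HodgeCM.Toy.Star

open exteriorPower Module Set Set.powersetCard

variable {R : Type*} [Field R] {V : Type*} [AddCommGroup V] [Module R V]
variable {I : Type*} [LinearOrder I] [Fintype I] (e : Basis I R V)

/-! ### The top subset -/

/-- `univ` as an element of `powersetCard I m` when `|I| = m`. -/
def univC {m : ℕ} (hm : Fintype.card I = m) : powersetCard I m :=
  ofCard (s := (Finset.univ : Finset I)) (by rw [Finset.card_univ, hm])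

omit [LinearOrder I] in
/-- (Ported verbatim from the HodgeCMPerL package; no docstring in the source.) -/
@[simp] lemma val_univC {m : ℕ} (hm : Fintype.card I = m) : (univC hm).val = Finset.univ := rfl

omit [LinearOrder I] in
/-- (Ported verbatim from the HodgeCMPerL package; no docstring in the source.) -/
lemma eq_univC {m : ℕ} (hm : Fintype.card I = m) (s : powersetCard I m) : s = univC hm := by
  apply Subtype.ext
  rw [val_univC]
  exact Finset.eq_univ_of_card _ (by rw [card_eq, hm])

/-- The top exterior power is the line spanned by `e_{univ}`. -/
lemma eq_coord_smul_top {m : ℕ} (hm : Fintype.card I = m) (z : ⋀[R]^m V) :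
    z = (e.exteriorPower m).coord (univC hm) z • e.exteriorPower m (univC hm) := by
  conv_lhs => rw [← (e.exteriorPower m).sum_repr z]
  rw [Fintype.sum_eq_single (univC hm) (fun s hs => absurd (eq_univC hm s) hs), Basis.coord_apply]

/-! ### Complementary products of wedge-basis vectors -/

section compl

variable {k l : ℕ} (hkl : k + l = Fintype.card I)

/-- (Ported verbatim from the HodgeCMPerL package; no docstring in the source.) -/
lemma disjoint_compl_val (T : powersetCard I l) : Disjoint (compl hkl T).val T.val := by
  rw [coe_compl]
  exact disjoint_compl_left

/-- (Ported verbatim from the HodgeCMPerL package; no docstring in the source.) -/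
lemma disjUnion_compl_eq (T : powersetCard I l) :
    disjUnion (disjoint_compl_val hkl T) = univC hkl.symm :=
  eq_univC _ _

/-- `e_S ∧ e_T = 0` for `|S| = k`, `|T| = l`, `k + l = |I|`, unless `S = Tᶜ`. -/
lemma basis_mul_basis_eq_zero (S : powersetCard I k) (T : powersetCard I l) (hST : S ≠ compl hkl T) :
    ((e.exteriorPower k S : ⋀[R]^k V) : ExteriorAlgebra R V) * ((e.exteriorPower l T : ⋀[R]^l V) :
      ExteriorAlgebra R V) = 0 := by
  rw [basis_apply, basis_apply, ιMulti_family_apply_coe, ιMulti_family_apply_coe]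
  apply ExteriorAlgebra.ιMulti_family_mul_of_not_disjoint
  intro hdis
  apply hST
  rw [eq_iff_subset]
  intro i hi
  rw [coe_compl, Finset.mem_compl]
  exact fun hiT => Finset.disjoint_left.mp hdis hi hiT

/-- `e_{Tᶜ} ∧ e_T = ± e_{univ}`. -/
lemma basis_compl_mul_basis (T : powersetCard I l) :
    ((e.exteriorPower k (compl hkl T) : ⋀[R]^k V) : ExteriorAlgebra R V) *
        ((e.exteriorPower l T : ⋀[R]^l V) : ExteriorAlgebra R V)
      = (permOfDisjoint (disjoint_compl_val hkl T)).sign •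
          ((e.exteriorPower (k + l) (univC hkl.symm) : ⋀[R]^(k + l) V) : ExteriorAlgebra R V) := by
  rw [basis_apply, basis_apply, basis_apply, ιMulti_family_apply_coe, ιMulti_family_apply_coe,
    ιMulti_family_apply_coe]
  refine (ExteriorAlgebra.ιMulti_family_mul_of_disjoint (R := R) e _ _ (disjoint_compl_val hkl T)).trans ?_
  rw [disjUnion_compl_eq]

/-- **Coefficient extraction**: `e_{Tᶜ} ∧ z = ± z_T · e_{univ}`. -/
theorem basis_compl_mul_eq (T : powersetCard I l) (z : ⋀[R]^l V) :
    ((e.exteriorPower k (compl hkl T) : ⋀[R]^k V) : ExteriorAlgebra R V) * (z : ExteriorAlgebra R V)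
      = (permOfDisjoint (disjoint_compl_val hkl T)).sign •
          ((e.exteriorPower l).repr z T •
            ((e.exteriorPower (k + l) (univC hkl.symm) : ⋀[R]^(k + l) V) : ExteriorAlgebra R V)) := by
  classical
  conv_lhs => rw [← (e.exteriorPower l).sum_repr z]
  rw [Submodule.coe_sum, Finset.mul_sum,
    Finset.sum_eq_single T (fun T' _ hT' => ?_) (fun h => absurd (Finset.mem_univ T) h),
    Submodule.coe_smul, mul_smul_comm, basis_compl_mul_basis, smul_comm]
  rw [Submodule.coe_smul, mul_smul_comm, basis_mul_basis_eq_zero e hkl _ _ (fun h => hT' ?_), smul_zero]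
  have := congrArg (compl hkl).symm h
  rw [Equiv.symm_apply_apply, Equiv.symm_apply_apply] at this
  exact this.symm

include hkl in
/-- The wedge pairing `⋀^k V × ⋀^l V → ⋀^{k+l} V` (`k + l = dim V`) has no right kernel. -/
theorem eq_zero_of_forall_basis_mul_eq_zero (z : ⋀[R]^l V)
    (h : ∀ S : powersetCard I k,
      ((e.exteriorPower k S : ⋀[R]^k V) : ExteriorAlgebra R V) * (z : ExteriorAlgebra R V) = 0) :
    z = 0 := by
  refine (e.exteriorPower l).repr.injective (Finsupp.ext fun T => ?_)
  have hT := h (compl hkl T)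
  rw [basis_compl_mul_eq, smul_eq_zero_iff_eq, smul_eq_zero] at hT
  rcases hT with hT | hT
  · simpa using hT
  · exact absurd ((Submodule.coe_eq_zero).mp hT) ((e.exteriorPower (k + l)).ne_zero (univC hkl.symm))

end compl

/-! ### The top power and the determinant -/

/-- An endomorphism acts on the top exterior power by its determinant. -/
theorem map_eq_det_smul [FiniteDimensional R V] {m : ℕ} (hm : Module.finrank R V = m) (f : V →ₗ[R] V)
    (z : ⋀[R]^m V) : map m f z = LinearMap.det f • z := by
  classical
  let b : Basis (Fin m) R V := (Module.finBasis R V).reindex (finCongr hm)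
  have hc : Fintype.card (Fin m) = m := Fintype.card_fin m
  let B := b.exteriorPower m
  -- it suffices to check generators `ιMulti v`
  suffices key : ∀ v : Fin m → V, map m f (ιMulti R m v) = LinearMap.det f • ιMulti R m v by
    have : map m f = LinearMap.det f • (LinearMap.id : ⋀[R]^m V →ₗ[R] ⋀[R]^m V) :=
      linearMap_ext (by
        ext v
        simp only [LinearMap.compAlternatingMap_apply, LinearMap.smul_apply, LinearMap.id_coe, id_eq]
        exact congrArg Subtype.val (key v))
    simpa using LinearMap.congr_fun this z
  intro v
  -- the coordinate of `ιMulti v` along `e_univ` is an alternating `m`-form, hence a multiple of `b.det`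
  let A : V [⋀^Fin m]→ₗ[R] R := (B.coord (univC hc)).compAlternatingMap (ιMulti R m)
  have hA : ∀ w : Fin m → V, B.coord (univC hc) (ιMulti R m w) = A b * b.det w := fun w => by
    have := congrArg (fun g : V [⋀^Fin m]→ₗ[R] R => g w) (A.eq_smul_basis_det b)
    simpa [A] using this
  rw [map_apply_ιMulti, eq_coord_smul_top b hc (ιMulti R m (f ∘ v)), eq_coord_smul_top b hc (ιMulti R m v),
    hA, hA, b.det_comp, smul_smul]
  congr 1
  ring

end HodgeCM.Toy.Star

end
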